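import Summits.AtomisticToContinuum.FouriersLaw.Theorems.BondHeatUncertaintySubdiffusiveBondHeatKernelGibbsA

/-!
# drefute certificate: the two-time case of `stub_pathLebesgueDuality` (line `lebesgue-flip-duality`,
crux stmt-AtomisticToContinuum-9122) IS the tree's Lebesgue duality — orientation and constant `e^{2γt}` agree.

The vocabulary (`Obs`, `swapObs`, `rawObs`, `fwdPath`, `revPath`, `workIntegral`, `bondHeat`) is copied VERBATIM
from `Cruxes/LinearResponseFTUR/Lines/lebesgue-flip-duality.lean` (sha256 586123c8…); `PathLebesgueDualityTwoTime`
is `PathLebesgueDuality` restricted to test functions `G o = g o.1 o.2.1` of the two endpoint slots.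
Positive helper (evidence for the lead, base case of the f.d.d. induction), not a refutation.
-/

noncomputable section

namespace Summit.AtomisticToContinuum.FouriersLaw.Cruxes.LinearResponseFTUR.Drefute

open MeasureTheory ProbabilityTheory Filter Topology
open scoped NNReal ENNReal
open Literature.MathematicalPhysics.KineticTheory
open Literature.MathematicalPhysics.KineticTheory.HeatConduction
open Literature.Probability.Process
open Summit.AtomisticToContinuum.FouriersLaw.Theorems.SubdiffusiveBondHeat

/-! ## Vocabulary (verbatim copies) -/

abbrev Obs (N : ℕ) : Type := PhaseSpace N × PhaseSpace N × ℝ × ℝ × ℝ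

def swapObs (N : ℕ) (p : Obs N) : Obs N := (p.2.1, p.1, p.2.2)

def workIntegral (P : OscillatorChain) (N : ℕ) (i : Fin N) (t : ℝ) (X : ℝ → PhaseSpace N) : ℝ :=
  ∫ s in (0 : ℝ)..t, (X s).2 i * partialQ i (P.hamiltonian N) (X s)

def bondHeat (P : OscillatorChain) (N : ℕ) (i : Fin N) (t : ℝ) (X : ℝ → PhaseSpace N) : ℝ :=
  ∫ s in (0 : ℝ)..t, P.bondCurrent N i (X s)

def rawObs (P : OscillatorChain) (N : ℕ) (i0 iN ib : Fin N) (t : ℝ) (z : PhaseSpace N)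
    (X : ℝ → PhaseSpace N) : Obs N :=
  (z, X t, workIntegral P N i0 t X, workIntegral P N iN t X, bondHeat P N ib t X)

def fwdPath (P : OscillatorChain) (N : ℕ) (T_L T_R : ℝ) (z : PhaseSpace N) (w : WienerPair) :
    ℝ → PhaseSpace N :=
  fun s => P.solMap N T_L T_R s z (pairPath w)

def revPath (P : OscillatorChain) (N : ℕ) (T_L T_R : ℝ) (y : PhaseSpace N) (w : WienerPair) :
    ℝ → PhaseSpace N :=
  fun s => sdeSolMap (fun x => -P.drift N x) (P.bathVecL N T_L) (P.bathVecR N T_R) s y (pairPath w)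

/-- `PathLebesgueDuality` of the skeleton, restricted to two-time test functions `G o = g o.1 o.2.1`. -/
def PathLebesgueDualityTwoTime : Prop :=
  ∀ ω₂ lam β γ : ℝ, 0 < ω₂ → 0 < lam → 0 < β → 0 < γ →
  ∀ (N : ℕ) (hN : 2 ≤ N) (T_L T_R : ℝ), 0 < T_L → 0 < T_R → ∀ t : ℝ, 0 < t → ∀ ib : Fin N,
  ∀ g : PhaseSpace N → PhaseSpace N → ℝ≥0∞, Measurable (Function.uncurry g) →
    let P := pinnedChain ω₂ lam β γ
    let i0 : Fin N := ⟨0, by omega⟩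
    let iN : Fin N := ⟨N - 1, by omega⟩
    let G : Obs N → ℝ≥0∞ := fun o => g o.1 o.2.1
    ∫⁻ z, ∫⁻ w, G (swapObs N (rawObs P N i0 iN ib t z (fwdPath P N T_L T_R z w))) ∂wienerPair =
      ENNReal.ofReal (Real.exp (2 * γ * t)) *
        ∫⁻ y, ∫⁻ w, G (rawObs P N i0 iN ib t y (revPath P N T_L T_R y w)) ∂wienerPair

/-- **The two-time case of K1 is the tree duality** `∫dx∫P_t(x,dy)H(x,y) = e^{2γt}∫dy∫P̂_t(y,dx)H(x,y)`
(`IsConfining.lintegral_langevinKernel_duality`) with `H(x,y) = g y x`, after `langevinKernel = transitionKernel`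
(`pinnedChain_langevinKernel_eq_transitionKernel`) and the law-of-the-flow lemmas on both sides. -/
theorem pathLebesgueDualityTwoTime_holds : PathLebesgueDualityTwoTime := by
  intro ω₂ lam β γ hω hl hβ hγ N hN T_L T_R hTL hTR t ht ib g hg P i0 iN G
  have hP : P.IsConfining := pinnedChain_isConfining hω hl.le hβ.le hγ.le
  set t' : ℝ≥0 := ⟨t, ht.le⟩ with ht'
  have htt : (t' : ℝ) = t := rfl
  have ht'pos : 0 < t' := ht
  -- unfold the observable slots
  have eL : ∀ z w, G (swapObs N (rawObs P N i0 iN ib t z (fwdPath P N T_L T_R z w))) =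
      g (P.solMap N T_L T_R t z (pairPath w)) z := fun z w => rfl
  have eR : ∀ y w, G (rawObs P N i0 iN ib t y (revPath P N T_L T_R y w)) =
      g y (sdeSolMap (fun x => -P.drift N x) (P.bathVecL N T_L) (P.bathVecR N T_R) t y (pairPath w)) :=
    fun y w => rfl
  simp_rw [eL, eR]
  -- left side: law of the forward flow = transitionKernel = langevinKernel
  have hgz : ∀ z, Measurable fun y => g y z := fun z => hg.comp (measurable_id.prodMk measurable_const)
  have hgy : ∀ y, Measurable fun x => g y x := fun y => hg.comp (measurable_const.prodMk measurable_id)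
  have L : ∀ z, ∫⁻ w, g (P.solMap N T_L T_R t z (pairPath w)) z ∂wienerPair =
      ∫⁻ y, g y z ∂(P.langevinKernel N T_L T_R t' z) := by
    intro z
    rw [pinnedChain_langevinKernel_eq_transitionKernel (hω := hω) (hl := hl.le) (hβ := hβ.le) (hγ := hγ.le),
      pinnedChain_lintegral_transitionKernel hω hl.le hβ.le hγ.le N T_L T_R t' z (hgz z)]
    rfl
  have R : ∀ y, ∫⁻ w, g y (sdeSolMap (fun x => -P.drift N x) (P.bathVecL N T_L) (P.bathVecR N T_R) t y
        (pairPath w)) ∂wienerPair = ∫⁻ x, g y x ∂(P.langevinRevKernel N T_L T_R t' y) := by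
    intro y
    rw [OscillatorChain.langevinRevKernel,
      (hP.reversedDrift N).toConfinedDrift.lintegral_sdeKernel (hP.bathVecL_mem_reversedDrift_noise N T_L)
        (hP.bathVecR_mem_reversedDrift_noise N T_R) t' y (hgy y)]
    rfl
  simp_rw [L, R]
  -- the tree duality with H (x, y) = g y x
  have hH : Measurable fun p : PhaseSpace N × PhaseSpace N => g p.2 p.1 := hg.comp measurable_swap
  have hN0 : 0 < N := by omega
  have D := hP.lintegral_langevinKernel_duality T_L T_R (pinnedChain_contDiff_U ω₂ lam β γ)
    (pinnedChain_contDiff_V ω₂ lam β γ) hN0 ht'pos hH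
  have hγP : P.γ = γ := rfl
  simp only [hγP, htt] at D
  exact D

end Summit.AtomisticToContinuum.FouriersLaw.Cruxes.LinearResponseFTUR.Drefute

end
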